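import Summits.PneNP.PneNP.Theorems.ChebyshevTracialDesignTracialProfilePolynomial
import HarnessLib

/-!
# Cell pnp-psdrank, route `ChebyshevTracialDesign`: harmonic layer decompositions are unique, so the VIRTUAL VALUE of a strategy is
# a well-defined number and the tracial truncation theorem holds for every harmonic datum

Harmonic backbone of the crux `TracialDecayExp20` (stmt-PneNP-19878), brick 22a (prover g7; route-independent part, no Theses import).
Brick 20 (`…TracialProfilePolynomial.tracial_value_truncation_explicit`) bounds `|Σ_U Σ_M W(U,M)·tr(X_U Y_M) + P(0)|` for a harmonic layer
datum `p` of the entries of `X` that the theorem itself constructs, `P(0) = (1/|PM|)·Σ_M Σ_{|A|≤D} tr(Q_A(p) Y_M)·knapsackMoment(|M|, t/2, |M[A]|)`.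
Here:
* `ladder_decomposition_unique` — for `2t ≤ n` the decomposition `f = Σ_{j≤t} (Wᵀ)^{t−j} p_j` (`p_j` harmonic of degree `j`) of a function on
  the `t`-sets is UNIQUE (the layers are mutually orthogonal with positive ladder norms, lit `ip_ladderSum_self` / `ladderProd_range_pos`);
* `virtual_value_eq_of_data` — hence two harmonic data of the entries of `X` on the `t`-cuts give the same matrix coefficients `Q_A` and the
  same averaged Grigoriev pseudo-expectation against every `Y`: the virtual value `P_{X,Y}(0)` is intrinsic;
* `tracial_value_truncation_of_data` — brick 20's tracial truncation theorem for EVERY datum `p`.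
[cite: LeePrakashDewolfYuen2016, App. B Thm. B.5, Cor. B.6 (arXiv text chunk 20)] [cite: Rothvoss2017, §2 (PDF p. 6)]
[cite: Grigoriev2001, Lemma 1.4 (PDF p. 8)]
Stature: support/instrument. WHAT THIS IS NOT: nothing on virtual nonnegativity itself, nothing on psd rank, no P-vs-NP content.
Supports stmt-PneNP-19878.
-/

set_option linter.dupNamespace false -- `Summit.PneNP.PneNP.…`: summit = sub-problem (D-0017)

noncomputable section

namespace Summit.PneNP.PneNP.Theorems.ChebyshevTracialDesignVirtualValueUnique

open Finset Matrix Polynomial Literature.Barriers.PneNP Literature.Combinatorics.Optimization Literature.Computability.Complexity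
open Literature.Combinatorics.AssociationSchemes Literature.Combinatorics.AssociationSchemes.JohnsonHarmonics
open Literature.Combinatorics.AssociationSchemes.JohnsonSpectrum
open Summit.PneNP.PneNP.Theorems.ChebyshevTracialDesignLevelTail
open Summit.PneNP.PneNP.Theorems.ChebyshevTracialDesignProfilePolynomial
open Summit.PneNP.PneNP.Theorems.ChebyshevTracialDesignTracialProfilePolynomial

variable {n : ℕ}

/-! ### §1 Harmonic layer decompositions on the `t`-sets are unique -/

/-- `Ker W_t` is closed under subtraction. -/
theorem isHarmonic_sub {t : ℕ} {u v : Finset (Fin n) → ℝ} (hu : IsHarmonic t u) (hv : IsHarmonic t v) :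
    IsHarmonic t (u - v) := by
  have h := hu.add (hv.smul (-1))
  rwa [neg_one_smul, ← sub_eq_add_neg] at h

/-- Iterated raising is additive: `(Wᵀ)^k (a − b) = (Wᵀ)^k a − (Wᵀ)^k b`. -/
theorem iterate_up_sub (k : ℕ) (a b : Finset (Fin n) → ℝ) : up^[k] (a - b) = up^[k] a - up^[k] b := by
  induction k with
  | zero => rfl
  | succ k ih => rw [Function.iterate_succ_apply', Function.iterate_succ_apply', Function.iterate_succ_apply', ih, map_sub]

/-- `⟪u, u⟫ = 0` forces `u = 0`. -/
theorem eq_zero_of_ip_self_eq_zero {u : Finset (Fin n) → ℝ} (h : ip u u = 0) : u = 0 := by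
  unfold ip at h
  have h' := (sum_eq_zero_iff_of_nonneg fun S _ => mul_self_nonneg (u S)).1 h
  funext S
  exact mul_self_eq_zero.1 (h' S (mem_univ _))

/-- **Uniqueness of the harmonic layer (ladder) decomposition** (`2t ≤ n`): if `Σ_{j≤t} (Wᵀ)^{t−j} p_j = Σ_{j≤t} (Wᵀ)^{t−j} p'_j` with
all `p_j, p'_j` harmonic of degree `j`, then `p_j = p'_j` for every `j ≤ t` (the layers are mutually orthogonal with positive ladder norms).
[cite: LeePrakashDewolfYuen2016, App. B Thm. B.5, Cor. B.6 (arXiv text chunk 20)] -/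
theorem ladder_decomposition_unique {t : ℕ} (ht : 2 * t ≤ n) (p p' : ℕ → Finset (Fin n) → ℝ)
    (hp : ∀ j, IsHarmonic j (p j)) (hp' : ∀ j, IsHarmonic j (p' j))
    (h : ∑ j ∈ range (t + 1), up^[t - j] (p j) = ∑ j ∈ range (t + 1), up^[t - j] (p' j)) :
    ∀ j, j ≤ t → p j = p' j := by
  set q : ℕ → Finset (Fin n) → ℝ := fun j => p j - p' j with hq
  have hqh : ∀ j, IsHarmonic j (q j) := fun j => isHarmonic_sub (hp j) (hp' j)
  have hsum : ∑ j ∈ range (t + 1), up^[t - j] (q j) = 0 := by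
    have : ∑ j ∈ range (t + 1), up^[t - j] (q j) =
        ∑ j ∈ range (t + 1), up^[t - j] (p j) - ∑ j ∈ range (t + 1), up^[t - j] (p' j) := by
      rw [← sum_sub_distrib]
      exact sum_congr rfl fun j _ => iterate_up_sub _ _ _
    rw [this, h, sub_self]
  have hip := ip_ladderSum_self (t := t) q hqh
  rw [hsum, ip_zero_left] at hip
  have hterms := (sum_eq_zero_iff_of_nonneg fun j hj => mul_nonneg
    (ladderProd_range_nonneg (by have := mem_range.1 hj; omega) (by omega)) (ip_self_nonneg (q j))).1 hip.symm
  intro j hjt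
  have hj := hterms j (mem_range.2 (by omega))
  have hpos := ladderProd_range_pos hjt ht
  have hq0 : ip (q j) (q j) = 0 := by
    rcases mul_eq_zero.1 hj with h0 | h0
    · exact absurd h0 hpos.ne'
    · exact h0
  have := eq_zero_of_ip_self_eq_zero hq0
  simp only [hq] at this
  exact sub_eq_zero.1 this

/-- **The virtual value does not depend on the harmonic datum.** Two harmonic layer data `p, p'` of the entries of `X` on the `t`-cuts
(`t = 2c'+1`, `2t ≤ n`) have the same entrywise low-part coefficients, hence the same averaged pseudo-expectation against any `Y`. -/
theorem virtual_value_eq_of_data {c' D r : ℕ} (ht : 2 * (2 * c' + 1) ≤ n) (X : OddSet n → Matrix (Fin r) (Fin r) ℝ)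
    (Y : PMatch n → Matrix (Fin r) (Fin r) ℝ) (p p' : Fin r × Fin r → ℕ → Finset (Fin n) → ℝ)
    (hp : ∀ ab j, IsHarmonic j (p ab j)) (hp' : ∀ ab j, IsHarmonic j (p' ab j))
    (hdec : ∀ ab (U : OddSet n), U.1.card = 2 * c' + 1 →
      X U ab.1 ab.2 = (∑ j ∈ range (2 * c' + 1 + 1), up^[2 * c' + 1 - j] (p ab j)) U.1)
    (hdec' : ∀ ab (U : OddSet n), U.1.card = 2 * c' + 1 →
      X U ab.1 ab.2 = (∑ j ∈ range (2 * c' + 1 + 1), up^[2 * c' + 1 - j] (p' ab j)) U.1) :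
    (Fintype.card (PMatch n) : ℝ)⁻¹ * ∑ M : PMatch n, ∑ A : {A : Finset (Fin n) // A.card ≤ D},
        (Matrix.of (fun a b : Fin r =>
            (∑ j ∈ range (2 * c' + 1 + 1), ((2 * c' + 1 - j).factorial : ℝ) • (if D < j then 0 else p (a, b) j)) A.1) * Y M).trace *
          knapsackMoment M.1.card (((2 * c' + 1 : ℕ) : ℝ) / 2) (M.1.filter fun e => ∃ a ∈ A.1, a ∈ e).card =
      (Fintype.card (PMatch n) : ℝ)⁻¹ * ∑ M : PMatch n, ∑ A : {A : Finset (Fin n) // A.card ≤ D},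
        (Matrix.of (fun a b : Fin r =>
            (∑ j ∈ range (2 * c' + 1 + 1), ((2 * c' + 1 - j).factorial : ℝ) • (if D < j then 0 else p' (a, b) j)) A.1) * Y M).trace *
          knapsackMoment M.1.card (((2 * c' + 1 : ℕ) : ℝ) / 2) (M.1.filter fun e => ∃ a ∈ A.1, a ∈ e).card := by
  -- the two ladder sums agree as functions (homogeneous of degree `t`, equal on the `t`-sets), hence layer by layer
  have hfun : ∀ ab : Fin r × Fin r, ∑ j ∈ range (2 * c' + 1 + 1), up^[2 * c' + 1 - j] (p ab j) =
      ∑ j ∈ range (2 * c' + 1 + 1), up^[2 * c' + 1 - j] (p' ab j) := by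
    intro ab
    funext U
    by_cases hU : U.card = 2 * c' + 1
    · have h1 := hdec ab ⟨U, ⟨c', hU⟩⟩ hU
      have h2 := hdec' ab ⟨U, ⟨c', hU⟩⟩ hU
      rw [← h1, ← h2]
    · rw [isHomog_ladderSum (p ab) (hp ab) U hU, isHomog_ladderSum (p' ab) (hp' ab) U hU]
  have heq : ∀ ab : Fin r × Fin r, ∀ j, j ≤ 2 * c' + 1 → p ab j = p' ab j :=
    fun ab => ladder_decomposition_unique ht (p ab) (p' ab) (hp ab) (hp' ab) (hfun ab)
  have hQ : ∀ (A : Finset (Fin n)) (a b : Fin r),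
      (∑ j ∈ range (2 * c' + 1 + 1), ((2 * c' + 1 - j).factorial : ℝ) • (if D < j then 0 else p (a, b) j)) A =
        (∑ j ∈ range (2 * c' + 1 + 1), ((2 * c' + 1 - j).factorial : ℝ) • (if D < j then 0 else p' (a, b) j)) A := by
    intro A a b
    refine congrFun (sum_congr rfl fun j hj => ?_) A
    rw [heq (a, b) j (by have := mem_range.1 hj; omega)]
  have hM : ∀ A : Finset (Fin n),
      (Matrix.of fun a b : Fin r =>
          (∑ j ∈ range (2 * c' + 1 + 1), ((2 * c' + 1 - j).factorial : ℝ) • (if D < j then 0 else p (a, b) j)) A) =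
        Matrix.of fun a b : Fin r =>
          (∑ j ∈ range (2 * c' + 1 + 1), ((2 * c' + 1 - j).factorial : ℝ) • (if D < j then 0 else p' (a, b) j)) A := by
    intro A
    ext a b
    simp only [Matrix.of_apply]
    exact hQ A a b
  congr 1
  refine sum_congr rfl fun M _ => sum_congr rfl fun A _ => ?_
  rw [hM A.1]

/-! ### §2 The tracial truncation theorem for every datum -/

/-- **The tracial degree-truncation theorem with explicit tail, for EVERY harmonic datum** (brick 20's
`tracial_value_truncation_explicit` stated the bound for a datum of its own choosing; by uniqueness it holds for all of them).
[cite: Rothvoss2017, §2 (PDF p. 6)] [cite: Grigoriev2001, Lemma 1.4 (PDF p. 8)] [cite: GriblingDelaatLaurent2019, §5] -/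
theorem tracial_value_truncation_of_data {c' T D r : ℕ} {Bv : ℝ} {C : Finset ℕ} {w : ℕ → ℝ} (hn : Even n)
    (hdes : IsExactDesign n (2 * c' + 1) T D Bv C w) (hD : D ≤ 2 * c')
    (X : OddSet n → Matrix (Fin r) (Fin r) ℝ) (Y : PMatch n → Matrix (Fin r) (Fin r) ℝ)
    (p : Fin r × Fin r → ℕ → Finset (Fin n) → ℝ) (hp : ∀ ab j, IsHarmonic j (p ab j))
    (hdec : ∀ ab (U : OddSet n), U.1.card = 2 * c' + 1 →
      X U ab.1 ab.2 = (∑ j ∈ range (2 * c' + 1 + 1), up^[2 * c' + 1 - j] (p ab j)) U.1) :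
    |∑ U : OddSet n, ∑ M : PMatch n, levelWeight n (2 * c' + 1) C w U M * (X U * Y M).trace +
        (Fintype.card (PMatch n) : ℝ)⁻¹ * ∑ M : PMatch n, ∑ A : {A : Finset (Fin n) // A.card ≤ D},
          (Matrix.of (fun a b : Fin r =>
            (∑ j ∈ range (2 * c' + 1 + 1), ((2 * c' + 1 - j).factorial : ℝ) • (if D < j then 0 else p (a, b) j)) A.1) *
              Y M).trace *
            knapsackMoment M.1.card (((2 * c' + 1 : ℕ) : ℝ) / 2) (M.1.filter fun e => ∃ a ∈ A.1, a ∈ e).card| ≤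
      (∑ c ∈ C, |w c|) *
        Real.sqrt ((∏ i ∈ range (D / 2 + 1), ((2 * i + 1 : ℝ) / ((n : ℝ) - 2 * i))) *
          ((∑ U : OddSet n, if U.1.card = 2 * c' + 1 then ∑ a, ∑ b, X U a b ^ 2 else 0) / (n.choose (2 * c' + 1) : ℝ)) *
          ((∑ M : PMatch n, ∑ a, ∑ b, Y M a b ^ 2) / (Fintype.card (PMatch n) : ℝ))) := by
  have ht : 2 * (2 * c' + 1) ≤ n := by have := hdes.2.1; omega
  obtain ⟨p', hp', hdec', hbound⟩ := tracial_value_truncation_explicit hn hdes hD X Y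
  rw [virtual_value_eq_of_data ht X Y p p' hp hp' hdec hdec']
  exact hbound

end Summit.PneNP.PneNP.Theorems.ChebyshevTracialDesignVirtualValueUnique
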